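import Summits.BirchSwinnertonDyer.Rank1Residual.GaloisImage.KuriharaRecordBSDpThreeLevelTwoEndModThree
import Summits.BirchSwinnertonDyer.Rank1Residual.GaloisImage.EPCTateFormula
import Literature.NumberTheory.Automorphic.AdicCompletionLocalField
import HarnessLib

/-!
# R1-61, part 5: the END-m2 record corollaries with Tate's local Euler–Poincaré characteristic
# DISCHARGED (`hEP` ↦ n1011-p04's theorem `EPCTate.localEulerPoincareCharacteristic`, p300886)
# (cell `b2b-bsdres`, team n1011, ROUTE-1 §33.3 / §36 R1-61; OWNERS row T-E2-REC; seat p18; lead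
# R5-75 (b)(i) CONSUMER RULE: "discharge `hEP` by `EPCTate.localEulerPoincareCharacteristic K` in your
# own file, one theorem per END, docstring 'hEP discharged by p300886'")

HONEST FRAMING (cell `b2b-bsdres`, run/shared/lean/b2b/bsd-rank1-residual/, verbatim in every
file): the goal of the cell is to DELETE the COMBINATION-SHAPED residual classes of the
Birch–Swinnerton-Dyer formula for ALL analytic-rank `≤ 1` elliptic curves over `ℚ` — "full BSD
formula for every rank `≤ 1` curve in class `C`" assembled STRICTLY from published theorems — so
that the rank-`≤ 1` remainder becomes exactly the CONSTRUCTION-SHAPED classes, which are TYPED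
(missing-input `Prop`s), NOT attempted. This is not "finishing BSD". Team n1011 (N10/N11, the
additive block `X4 ∧ p = 3`): research route; PER-PAIR record shape, NOT a class theorem; TOOL
theorems only (no definition, no named fact); nothing booked; no mark / label moved; the shapes
CLOSE NOTHING.  END-m2 is DEBT REDUCTION on class A2 (`BSD(E,3)` only where `ord₃(L(E,1)/Ω_E) ≤ 2`),
not coverage: CONDITIONAL on the UPPER-half facts of the X4 chain of record, Cassels–Tate, the
Poitou–Tate duality as the named fact `hPT` (or the family `inv hperf hsum hcompl`), and the ONE port
`KatoKuriharaPortThreeAt W 1 v₃` (FLAG `K22-Thm3.13-PORT@3`, construction-shaped, NOT in print at `3`);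
NO [S24] fact; and — from this file on — NO `hEP` binder: Tate's local Euler–Poincaré characteristic
formula is n1011-p04's THEOREM `EPCTate.localEulerPoincareCharacteristic` (p300886), a hypothesis
DISCHARGED BY A THEOREM (not relabelled).  The Kurihara values stay EVIDENCE hypotheses.

## What and why (lead R5-75 (b)(i))

Every END-m2 corollary of parts 1–4 carries
`hEP : ∀ v, localEulerPoincareCharacteristic (v.adicCompletion ℚ)` (Milne ADT I Thm. 2.8), used by
n1011-p15's END-m2 (core rank one of `𝓕̄_can`) and by the base-rigidity injectivity.  T-EPC settled it
in the kernel: `EPCTate.localEulerPoincareCharacteristic F` for every non-archimedean local field of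
characteristic `0` — in particular for `ℚ_v = v.adicCompletion ℚ` (`localEulerPoincareCharacteristic_rat`
below; the local-field instance is the tree's `instIsNonarchimedeanLocalFieldAdicCompletion`,
`CharZero` from `ℚ ↪ ℚ_v`).  This file is the consumer's append, one theorem per record-facing END:

* `localEulerPoincareCharacteristic_rat` — `hEP` for `ℚ`, once, BY NAME;
* `exists_ne_zero_mem_selmerGroup_three_of_port_of_kolyvaginProduct_levelTwo_of_baseRigidity_noEP`
  — part 1's E2-1 (`Sel₃(E) ≠ 0`) minus `hEP`;
* `bsdp_three_{of_towerSurj,potMult}_of_levelTwoCertificates_of_facts_noRank_noEP` — part 3's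
  named-facts, `hr`-free record corollaries minus `hEP` (mod-`9` certificate currency);
* `bsdp_three_{of_towerSurj,potMult}_of_levelTwoCertificates_of_facts_noRank_modThree_noEP` — part 4's
  mod-`3`-currency twins minus `hEP`.

So an END-m2 record now reads: NAMED FACTS {hKatoS hDel hGZK hmod hmodD hKatoχ h26 hCT hPT} +
PORT {hPort at `t = 1`} + ROW (kernel theorems) + the optimal datum + VALUES — nothing else.

References: J. S. Milne, *Arithmetic Duality Theorems* (2006) I Thm. 2.8, Thm. 4.10 [MilneADT2006];
J.-P. Serre, *Galois Cohomology* (1997) II §5.7 Thm. 5 [SerreGaloisCohomology1997]; C.-H. Kim, AJM 148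
(2026) Thm. 1.9 (6), Thm. 3.13 [Kim2022StructureSelmer]; K. Rubin, PCMI 18 (2011) Thm. 2.8.4, Cor. 2.8.9
[Rubin2011]; K. Kato, Astérisque 295 (2004) Thm. 14.5 (3) [Kato2004Asterisque]; D. Delbourgo (1998)
Prop. 4 [Delbourgo1998]; A. Agashe, K. Ribet, W. Stein (2006) Thm. 2.6 [AgasheRibetStein2006].
-/

noncomputable section

open scoped Classical NumberField ContRepresentation
open Function Field NumberField IsDedekindDomain IsDedekindDomain.HeightOneSpectrum WeierstrassCurve
  CongruenceSubgroup
  Literature.NumberTheory.EllipticCurves Literature.NumberTheory.EllipticCurves.ModularForms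
  Literature.NumberTheory.EllipticCurves.Rank1Residual
  Literature.NumberTheory.EllipticCurves.AgasheRibetStein2006
  Literature.NumberTheory.GaloisRepresentations
  Literature.NumberTheory.GaloisRepresentations.DiscreteGaloisModule Literature.NumberTheory.GaloisCohomology
  Rat.HeightOneSpectrum
  Summit.BirchSwinnertonDyer.Rank1Residual.Additive Summit.BirchSwinnertonDyer.Rank1Residual.X4

namespace Summit.BirchSwinnertonDyer.Rank1Residual.GaloisImage.Assembly

/-! ### Tate's local Euler–Poincaré characteristic at the finite places of `ℚ`, by name -/

/-- **`hEP` for `ℚ`, DISCHARGED (p300886)**: at every finite place `v` of `ℚ` the local field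
`ℚ_v = v.adicCompletion ℚ` satisfies Tate's local Euler–Poincaré characteristic formula
`localEulerPoincareCharacteristic ℚ_v` — n1011-p04's `EPCTate.localEulerPoincareCharacteristic`
(T-EPC, every characteristic-`0` non-archimedean local field), with the tree's local-field instance
on `v.adicCompletion ℚ` and `CharZero` from `ℚ ↪ ℚ_v`.  hEP discharged by p300886.
[cite: MilneADT2006, Ch. I §2, Thm. 2.8 (p. 31)] [cite: SerreGaloisCohomology1997, II §5.7 Thm. 5] -/
theorem localEulerPoincareCharacteristic_rat :
    ∀ v : HeightOneSpectrum (𝓞 ℚ), localEulerPoincareCharacteristic (v.adicCompletion ℚ) := fun v =>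
  haveI : CharZero (v.adicCompletion ℚ) :=
    charZero_of_injective_algebraMap (algebraMap ℚ (v.adicCompletion ℚ)).injective
  EPCTate.localEulerPoincareCharacteristic (v.adicCompletion ℚ)

/-! ### The END-m2 ENDs without `hEP` -/

/-- **`Sel₃(E) ≠ 0` on a class-A2 row from ONE depth-one Kurihara non-vanishing — [S24]-FREE and
`hEP`-FREE.**  Part 1's
`exists_ne_zero_mem_selmerGroup_three_of_port_of_kolyvaginProduct_levelTwo_of_baseRigidity` with the
binder `hEP` DISCHARGED by `localEulerPoincareCharacteristic_rat` (hEP discharged by p300886); every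
other binder unchanged and in the same order.  CLOSES NOTHING.
[cite: Kim2022StructureSelmer, Thm. 3.13] [cite: Rubin2011, Thm. 2.8.4 and Cor. 2.8.9]
[cite: MilneADT2006, Ch. I §2, Thm. 2.8 (p. 31)] -/
theorem exists_ne_zero_mem_selmerGroup_three_of_port_of_kolyvaginProduct_levelTwo_of_baseRigidity_noEP
    (W : WeierstrassCurve ℚ) [W.IsElliptic] [W.IsGloballyMinimal]
    (hadd : haveI : Fact (Nat.Prime 3) := ⟨Nat.prime_three⟩; Addv W 3)
    (hc3 : ¬ 3 ∣ (W.baseChange ℚ_[3]).localTamagawaNumber ℤ_[3])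
    (htower : ∀ m : ℕ, W.HasSurjectiveModNGaloisRep (3 ^ m : ℕ))
    (ht1 : Nat.card {Q : (W.baseChange ℚ_[3]).toAffine.Point // (3 : ℕ) • Q = 0} = 3 ^ 1)
    {N : ℕ} [NeZero N] (D : ModularParametrizationData W N)
    (hcP : ¬ ((3 : ℕ) : ℤ) ∣ D.maninConstant)
    (hper : ∃ u : ℚ, ‖(u : ℚ_[3])‖ = 1 ∧ W.realPeriodRat = u * plusPeriod D.f)
    (inv : LocalInvariants ℚ 3) (hperf : inv.IsPerfect) (hsum : inv.SumLocalTermEqZero)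
    (hcompl : inv.SelmerComplement)
    (v₃ : HeightOneSpectrum (𝓞 ℚ)) (hv₃ : ((3 : ℕ) : 𝓞 ℚ) ∈ v₃.asIdeal)
    (hPort : KatoKuriharaPortThreeAt W 1 v₃)
    (n : ℕ) [NeZero n] (hn : Kato.IsKolyvaginProduct W 3 3 n)
    (hcyc : ∀ (ℓ : ℕ) [Fact ℓ.Prime], ℓ ∣ n →
      Nat.card {P : ((integralModelInt W).map (Int.castRingHom (ZMod ℓ))).toAffine.Point //
        3 • P = 0} ≤ 3)
    (ψ : (ℓ : ℕ) → (ZMod ℓ)ˣ →* Multiplicative (ZMod (3 ^ 2)))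
    (hψ : ∀ ℓ ∈ n.primeFactors, Function.Surjective (ψ ℓ))
    (hcert : (3 : ZMod (3 ^ 2)) * kuriharaNumber D.f (3 ^ 2) n ψ ≠ 0)
    (hzero₉ : (3 : ZMod (3 ^ 2)) * kuriharaNumber D.f (3 ^ 2) 1 ψ = 0) :
    ∃ x ∈ (W.kummerSelmerStructure ((3 : ℕ) : ℤ)).selmerGroup, x ≠ 0 :=
  exists_ne_zero_mem_selmerGroup_three_of_port_of_kolyvaginProduct_levelTwo_of_baseRigidity W hadd hc3
    htower ht1 D hcP hper inv hperf hsum hcompl localEulerPoincareCharacteristic_rat v₃ hv₃ hPort n hn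
    hcyc ψ hψ hcert hzero₉

/-- **END-m2 RECORD COROLLARY, NAMED-FACTS form, `hr`-FREE, `hEP`-FREE (potentially GOOD rows /
tower form).**  Part 3's `bsdp_three_of_towerSurj_of_levelTwoCertificates_of_facts_noRank` with `hEP`
DISCHARGED by `localEulerPoincareCharacteristic_rat` (hEP discharged by p300886); the record reads
NAMED FACTS {hKatoS hDel hGZK hmod hmodD hKatoχ h26 hCT hPT} + PORT + ROW + datum + VALUES.
CLOSES NOTHING; values = EVIDENCE.
[cite: Kim2022StructureSelmer, Thm. 1.9 (6) and Thm. 3.13] [cite: MilneADT2006, Ch. I, Thm. 2.8 and Thm. 4.10]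
[cite: Kato2004Asterisque, Thm. 14.5 (3) (p. 236)] [cite: AgasheRibetStein2006, Thm. 2.6 (p. 619)] -/
theorem bsdp_three_of_towerSurj_of_levelTwoCertificates_of_facts_noRank_noEP
    (hKatoS : Kato2004.rankZero_padicValNat_sha_le_sub_localTamagawa_of_additive_potGood_of_imageContainsSL2)
    (hDel : Delbourgo1998.prop4_rankZero_pow_dvd_constantCoeff)
    (hGZK : rank_eq_analyticRank_of_analyticRank_le_one) (hmod : hasEntireLFunction_rat)
    (hmodD : nonempty_modularParametrizationData)
    (hKatoχ : Wuthrich2014.kato_halfEigenCharIdeal_dvd_cyclotomicPrime_of_surjective)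
    (h26 : cremona_abs_maninConstant_eq_one_of_level_le)
    (hCT : exists_casselsTate_pairing (K := ℚ))
    (hPT : poitouTate_selmerStructure_duality ℚ)
    (W : WeierstrassCurve ℚ) [W.IsElliptic] [W.IsGloballyMinimal]
    {E₀ : WeierstrassCurve ℤ} (hI : integralModelInt W = E₀)
    (hΔ : (3 : ℤ) ∣ E₀.Δ) (hc₄ : (3 : ℤ) ∣ E₀.c₄)
    (htower : ∀ m : ℕ, W.HasSurjectiveModNGaloisRep (3 ^ m : ℕ))
    (ht1 : Nat.card {Q : (W.baseChange ℚ_[3]).toAffine.Point // (3 : ℕ) • Q = 0} = 3 ^ 1)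
    (htam : ¬ 3 ∣ W.tamagawaProduct)
    {N : ℕ} [NeZero N] (hN : N ≤ 130000) (D : ModularParametrizationData W N)
    (hopt : ∀ z ∈ D.L.lattice, ∃ w ∈ periodLattice D.f, z = D.c * w)
    (v₃ : HeightOneSpectrum (𝓞 ℚ)) (hv₃ : ((3 : ℕ) : 𝓞 ℚ) ∈ v₃.asIdeal)
    (hPort : KatoKuriharaPortThreeAt W 1 v₃)
    (n : ℕ) [NeZero n] (hn : Kato.IsKolyvaginProduct W 3 3 n)
    (hcyc : ∀ (ℓ : ℕ) [Fact ℓ.Prime], ℓ ∣ n →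
      Nat.card {P : ((integralModelInt W).map (Int.castRingHom (ZMod ℓ))).toAffine.Point //
        3 • P = 0} ≤ 3)
    (ψ : (ℓ : ℕ) → (ZMod ℓ)ˣ →* Multiplicative (ZMod (3 ^ 2)))
    (hψ : ∀ ℓ ∈ n.primeFactors, Function.Surjective (ψ ℓ))
    (hcert : (3 : ZMod (3 ^ 2)) * kuriharaNumber D.f (3 ^ 2) n ψ ≠ 0)
    (hzero₉ : (3 : ZMod (3 ^ 2)) * kuriharaNumber D.f (3 ^ 2) 1 ψ = 0)
    (ψ₂₇ : (ℓ : ℕ) → (ZMod ℓ)ˣ →* Multiplicative (ZMod (3 ^ 3)))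
    (hunit₁ : kuriharaNumber D.f (3 ^ 3) 1 ψ₂₇ ≠ 0) :
    BSDp W 3 :=
  bsdp_three_of_towerSurj_of_levelTwoCertificates_of_facts_noRank hKatoS hDel hGZK hmod hmodD hKatoχ h26
    hCT W hI hΔ hc₄ htower ht1 htam hN D hopt hPT localEulerPoincareCharacteristic_rat v₃ hv₃ hPort n hn
    hcyc ψ hψ hcert hzero₉ ψ₂₇ hunit₁

/-- **END-m2 RECORD COROLLARY, NAMED-FACTS form, `hr`-FREE, `hEP`-FREE (potentially MULTIPLICATIVE
rows).**  Part 3's `bsdp_three_potMult_of_levelTwoCertificates_of_facts_noRank` with `hEP` DISCHARGED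
by `localEulerPoincareCharacteristic_rat` (hEP discharged by p300886).  CLOSES NOTHING; values = EVIDENCE.
[cite: Kim2022StructureSelmer, Thm. 1.9 (6) and Thm. 3.13] [cite: MilneADT2006, Ch. I, Thm. 2.8 and Thm. 4.10]
[cite: Delbourgo1998, Prop. 4 (p. 144)] [cite: AgasheRibetStein2006, Thm. 2.6 (p. 619)] -/
theorem bsdp_three_potMult_of_levelTwoCertificates_of_facts_noRank_noEP
    (hKatoS : Kato2004.rankZero_padicValNat_sha_le_sub_localTamagawa_of_additive_potGood_of_imageContainsSL2)
    (hDel : Delbourgo1998.prop4_rankZero_pow_dvd_constantCoeff)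
    (hGZK : rank_eq_analyticRank_of_analyticRank_le_one) (hmod : hasEntireLFunction_rat)
    (hmodD : nonempty_modularParametrizationData)
    (hKatoχ : Wuthrich2014.kato_halfEigenCharIdeal_dvd_cyclotomicPrime_of_surjective)
    (h26 : cremona_abs_maninConstant_eq_one_of_level_le)
    (hCT : exists_casselsTate_pairing (K := ℚ))
    (hPT : poitouTate_selmerStructure_duality ℚ)
    (W : WeierstrassCurve ℚ) [W.IsElliptic] [W.IsGloballyMinimal]
    {E₀ : WeierstrassCurve ℤ} (hI : integralModelInt W = E₀)
    (hΔ : (3 : ℤ) ∣ E₀.Δ) (hc₄ : (3 : ℤ) ∣ E₀.c₄)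
    (htower : ∀ m : ℕ, W.HasSurjectiveModNGaloisRep (3 ^ m : ℕ)) (hjneg : padicValRat 3 W.j < 0)
    (hc3 : ¬ 3 ∣ (W.baseChange ℚ_[3]).localTamagawaNumber ℤ_[3])
    (ht1 : Nat.card {Q : (W.baseChange ℚ_[3]).toAffine.Point // (3 : ℕ) • Q = 0} = 3 ^ 1)
    {N : ℕ} [NeZero N] (hN : N ≤ 130000) (D : ModularParametrizationData W N)
    (hopt : ∀ z ∈ D.L.lattice, ∃ w ∈ periodLattice D.f, z = D.c * w)
    (v₃ : HeightOneSpectrum (𝓞 ℚ)) (hv₃ : ((3 : ℕ) : 𝓞 ℚ) ∈ v₃.asIdeal)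
    (hPort : KatoKuriharaPortThreeAt W 1 v₃)
    (n : ℕ) [NeZero n] (hn : Kato.IsKolyvaginProduct W 3 3 n)
    (hcyc : ∀ (ℓ : ℕ) [Fact ℓ.Prime], ℓ ∣ n →
      Nat.card {P : ((integralModelInt W).map (Int.castRingHom (ZMod ℓ))).toAffine.Point //
        3 • P = 0} ≤ 3)
    (ψ : (ℓ : ℕ) → (ZMod ℓ)ˣ →* Multiplicative (ZMod (3 ^ 2)))
    (hψ : ∀ ℓ ∈ n.primeFactors, Function.Surjective (ψ ℓ))
    (hcert : (3 : ZMod (3 ^ 2)) * kuriharaNumber D.f (3 ^ 2) n ψ ≠ 0)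
    (hzero₉ : (3 : ZMod (3 ^ 2)) * kuriharaNumber D.f (3 ^ 2) 1 ψ = 0)
    (ψ₂₇ : (ℓ : ℕ) → (ZMod ℓ)ˣ →* Multiplicative (ZMod (3 ^ 3)))
    (hunit₁ : kuriharaNumber D.f (3 ^ 3) 1 ψ₂₇ ≠ 0) :
    BSDp W 3 :=
  bsdp_three_potMult_of_levelTwoCertificates_of_facts_noRank hKatoS hDel hGZK hmod hmodD hKatoχ h26 hCT
    W hI hΔ hc₄ htower hjneg hc3 ht1 hN D hopt hPT localEulerPoincareCharacteristic_rat v₃ hv₃ hPort n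
    hn hcyc ψ hψ hcert hzero₉ ψ₂₇ hunit₁

/-- **END-m2 RECORD COROLLARY, NAMED-FACTS form, `hr`-FREE, `hEP`-FREE, mod-`3` CURRENCY
(potentially GOOD rows / tower form).**  Part 4's
`bsdp_three_of_towerSurj_of_levelTwoCertificates_of_facts_noRank_modThree` with `hEP` DISCHARGED by
`localEulerPoincareCharacteristic_rat` (hEP discharged by p300886); certificate = the END-m1 / engine
fields (`ψ` onto `ℤ/3`, `δ̃_n ≢ 0`, `δ̃_1 ≡ 0 (mod 3)`, `δ̃_1 ≢ 0 (mod 27)`) + `hnN : gcd(n, N) = 1`.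
CLOSES NOTHING; values = EVIDENCE.
[cite: Kim2022StructureSelmer, §1.4.3, Thm. 1.9 (6) and Thm. 3.13] [cite: MilneADT2006, Ch. I, Thm. 2.8 and Thm. 4.10]
[cite: Kato2004Asterisque, Thm. 14.5 (3) (p. 236)] [cite: AgasheRibetStein2006, Thm. 2.6 (p. 619)] -/
theorem bsdp_three_of_towerSurj_of_levelTwoCertificates_of_facts_noRank_modThree_noEP
    (hKatoS : Kato2004.rankZero_padicValNat_sha_le_sub_localTamagawa_of_additive_potGood_of_imageContainsSL2)
    (hDel : Delbourgo1998.prop4_rankZero_pow_dvd_constantCoeff)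
    (hGZK : rank_eq_analyticRank_of_analyticRank_le_one) (hmod : hasEntireLFunction_rat)
    (hmodD : nonempty_modularParametrizationData)
    (hKatoχ : Wuthrich2014.kato_halfEigenCharIdeal_dvd_cyclotomicPrime_of_surjective)
    (h26 : cremona_abs_maninConstant_eq_one_of_level_le)
    (hCT : exists_casselsTate_pairing (K := ℚ))
    (hPT : poitouTate_selmerStructure_duality ℚ)
    (W : WeierstrassCurve ℚ) [W.IsElliptic] [W.IsGloballyMinimal]
    {E₀ : WeierstrassCurve ℤ} (hI : integralModelInt W = E₀)
    (hΔ : (3 : ℤ) ∣ E₀.Δ) (hc₄ : (3 : ℤ) ∣ E₀.c₄)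
    (htower : ∀ m : ℕ, W.HasSurjectiveModNGaloisRep (3 ^ m : ℕ))
    (ht1 : Nat.card {Q : (W.baseChange ℚ_[3]).toAffine.Point // (3 : ℕ) • Q = 0} = 3 ^ 1)
    (htam : ¬ 3 ∣ W.tamagawaProduct)
    {N : ℕ} [NeZero N] (hN : N ≤ 130000) (D : ModularParametrizationData W N)
    (hopt : ∀ z ∈ D.L.lattice, ∃ w ∈ periodLattice D.f, z = D.c * w)
    (v₃ : HeightOneSpectrum (𝓞 ℚ)) (hv₃ : ((3 : ℕ) : 𝓞 ℚ) ∈ v₃.asIdeal)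
    (hPort : KatoKuriharaPortThreeAt W 1 v₃)
    (n : ℕ) [NeZero n] (hn : Kato.IsKolyvaginProduct W 3 3 n) (hnN : Nat.Coprime n N)
    (hcyc : ∀ (ℓ : ℕ) [Fact ℓ.Prime], ℓ ∣ n →
      Nat.card {P : ((integralModelInt W).map (Int.castRingHom (ZMod ℓ))).toAffine.Point //
        3 • P = 0} ≤ 3)
    (ψ : (ℓ : ℕ) → (ZMod ℓ)ˣ →* Multiplicative (ZMod (3 ^ 1)))
    (hψ : ∀ ℓ ∈ n.primeFactors, Function.Surjective (ψ ℓ))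
    (hcert : kuriharaNumber D.f (3 ^ 1) n ψ ≠ 0)
    (hzero₁ : kuriharaNumber D.f (3 ^ 1) 1 ψ = 0)
    (ψ₂₇ : (ℓ : ℕ) → (ZMod ℓ)ˣ →* Multiplicative (ZMod (3 ^ 3)))
    (hunit₁ : kuriharaNumber D.f (3 ^ 3) 1 ψ₂₇ ≠ 0) :
    BSDp W 3 :=
  bsdp_three_of_towerSurj_of_levelTwoCertificates_of_facts_noRank_modThree hKatoS hDel hGZK hmod hmodD
    hKatoχ h26 hCT W hI hΔ hc₄ htower ht1 htam hN D hopt hPT localEulerPoincareCharacteristic_rat v₃ hv₃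
    hPort n hn hnN hcyc ψ hψ hcert hzero₁ ψ₂₇ hunit₁

/-- **END-m2 RECORD COROLLARY, NAMED-FACTS form, `hr`-FREE, `hEP`-FREE, mod-`3` CURRENCY
(potentially MULTIPLICATIVE rows).**  Part 4's
`bsdp_three_potMult_of_levelTwoCertificates_of_facts_noRank_modThree` with `hEP` DISCHARGED by
`localEulerPoincareCharacteristic_rat` (hEP discharged by p300886).  CLOSES NOTHING; values = EVIDENCE.
[cite: Kim2022StructureSelmer, §1.4.3, Thm. 1.9 (6) and Thm. 3.13] [cite: MilneADT2006, Ch. I, Thm. 2.8 and Thm. 4.10]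
[cite: Delbourgo1998, Prop. 4 (p. 144)] [cite: AgasheRibetStein2006, Thm. 2.6 (p. 619)] -/
theorem bsdp_three_potMult_of_levelTwoCertificates_of_facts_noRank_modThree_noEP
    (hKatoS : Kato2004.rankZero_padicValNat_sha_le_sub_localTamagawa_of_additive_potGood_of_imageContainsSL2)
    (hDel : Delbourgo1998.prop4_rankZero_pow_dvd_constantCoeff)
    (hGZK : rank_eq_analyticRank_of_analyticRank_le_one) (hmod : hasEntireLFunction_rat)
    (hmodD : nonempty_modularParametrizationData)
    (hKatoχ : Wuthrich2014.kato_halfEigenCharIdeal_dvd_cyclotomicPrime_of_surjective)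
    (h26 : cremona_abs_maninConstant_eq_one_of_level_le)
    (hCT : exists_casselsTate_pairing (K := ℚ))
    (hPT : poitouTate_selmerStructure_duality ℚ)
    (W : WeierstrassCurve ℚ) [W.IsElliptic] [W.IsGloballyMinimal]
    {E₀ : WeierstrassCurve ℤ} (hI : integralModelInt W = E₀)
    (hΔ : (3 : ℤ) ∣ E₀.Δ) (hc₄ : (3 : ℤ) ∣ E₀.c₄)
    (htower : ∀ m : ℕ, W.HasSurjectiveModNGaloisRep (3 ^ m : ℕ)) (hjneg : padicValRat 3 W.j < 0)
    (hc3 : ¬ 3 ∣ (W.baseChange ℚ_[3]).localTamagawaNumber ℤ_[3])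
    (ht1 : Nat.card {Q : (W.baseChange ℚ_[3]).toAffine.Point // (3 : ℕ) • Q = 0} = 3 ^ 1)
    {N : ℕ} [NeZero N] (hN : N ≤ 130000) (D : ModularParametrizationData W N)
    (hopt : ∀ z ∈ D.L.lattice, ∃ w ∈ periodLattice D.f, z = D.c * w)
    (v₃ : HeightOneSpectrum (𝓞 ℚ)) (hv₃ : ((3 : ℕ) : 𝓞 ℚ) ∈ v₃.asIdeal)
    (hPort : KatoKuriharaPortThreeAt W 1 v₃)
    (n : ℕ) [NeZero n] (hn : Kato.IsKolyvaginProduct W 3 3 n) (hnN : Nat.Coprime n N)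
    (hcyc : ∀ (ℓ : ℕ) [Fact ℓ.Prime], ℓ ∣ n →
      Nat.card {P : ((integralModelInt W).map (Int.castRingHom (ZMod ℓ))).toAffine.Point //
        3 • P = 0} ≤ 3)
    (ψ : (ℓ : ℕ) → (ZMod ℓ)ˣ →* Multiplicative (ZMod (3 ^ 1)))
    (hψ : ∀ ℓ ∈ n.primeFactors, Function.Surjective (ψ ℓ))
    (hcert : kuriharaNumber D.f (3 ^ 1) n ψ ≠ 0)
    (hzero₁ : kuriharaNumber D.f (3 ^ 1) 1 ψ = 0)
    (ψ₂₇ : (ℓ : ℕ) → (ZMod ℓ)ˣ →* Multiplicative (ZMod (3 ^ 3)))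
    (hunit₁ : kuriharaNumber D.f (3 ^ 3) 1 ψ₂₇ ≠ 0) :
    BSDp W 3 :=
  bsdp_three_potMult_of_levelTwoCertificates_of_facts_noRank_modThree hKatoS hDel hGZK hmod hmodD
    hKatoχ h26 hCT W hI hΔ hc₄ htower hjneg hc3 ht1 hN D hopt hPT localEulerPoincareCharacteristic_rat v₃
    hv₃ hPort n hn hnN hcyc ψ hψ hcert hzero₁ ψ₂₇ hunit₁

end Summit.BirchSwinnertonDyer.Rank1Residual.GaloisImage.Assembly

end
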